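import Mathlib
import HarnessLib
import Literature.Analysis.FluidPDE.ClassicalSolution
import Literature.Analysis.FluidPDE.LerayHopf
import Literature.Analysis.FluidPDE.SelfSimilar
import Literature.Analysis.FluidPDE.LocalTypeI
import Literature.Analysis.FluidPDE.VectorCalculus
import Literature.Analysis.FluidPDE.NSBoundedMildOseen
import Literature.Analysis.FluidPDE.NSLocalLerayBackwardUniqueness
import Literature.Analysis.UnboundedOperators.HeatKernel
import Summits.NavierStokesRegularity.NavierStokesRegularity.Theorems.ChiralWindowDoorDefs
import Summits.NavierStokesRegularity.NavierStokesRegularity.Theorems.ChiralWindowDoorEssLocalClass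
import Summits.NavierStokesRegularity.NavierStokesRegularity.Theorems.LocalSineTubeDoorProfileAlignedWindowRigidityAncient
import Summits.NavierStokesRegularity.NavierStokesRegularity.Theorems.PoloidalWindowDoorPoloidalWindowRigiditySymmetryGerms

/-!
# Door S20 «ChiralWindowDoor» — the line of K2 `ChiralProfileRigidity` kernel-resident: K2 and the door `Target`
# from the OPEN stub texts (B1′, B2′, B3, B5a, the analyticity of `Λ` on slices, K1), with B5b discharged

Door S20 of nsreg-p1's local Type-I door family (`HOME/ns-regularity-ideate-p1/r19/ROUND-19-DRAFT.md`, texts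
`r19/Sketch20v4.lean` 20ef4abc247f95cb, line `r19/Sketch20v5.lean` 7f13084196f4f031; DESIGN-ONLY, route NOT born).
The door: a classical Leray–Hopf flow, locally space–time Type I at `(x₀,T)`, whose scale-normalised CHIRALITY DEFECT
`(curl − Λ)(zoomed slice)` fades in `L¹` on one similarity window is backward bounded at `x₀` — PROVIDED chiral Type-I
ancient mild profiles are not backward-singular (K2).  nsreg-p1's line for K2 (R19-LINE): K2 ⟸ spread ∧ the
everywhere-form residue `HomochiralProfileRigidity`; the residue ⟸ B1′ ∧ B2′ ∧ B3 ∧ B5a ∧ B5b (B4 = bookkeeping);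
spread ⟸ «`Λ(v s)` is real-analytic on slices».  This file puts those compositions in the tree with every text spelled
out VERBATIM over the substrate `…Theorems.ChiralWindowDoorDefs` and with B5b replaced by its PROOF
(`…ChiralWindowDoorEssLocalClass.essLocalClass`):

* `chiralSpread_of_sliceAnalytic` — the spread stub `stub_chiralSpread` (text verbatim) FROM the one analytic input
  «`AnalyticOnNhd ℝ (fracLapHalf (v s)) univ` on every slice of the class» (tree `analyticOnNhd_slice`, Literature
  `analyticOnNhd_curl`, identity theorem `eq_of_eqOn_open`) — nsreg-p1 `r19/ChiralSpread.lean` c626fb10ce24f96d;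
* `homochiralProfileRigidity_of_B` — **the everywhere-form residue `HomochiralProfileRigidity` (text verbatim) FROM the
  texts of B1′ `stub_localHelicityLower`, B2′ `stub_localDissipationLower`, B3 `stub_helicityBudget`, B5a
  `stub_sobolevFatou` ALONE** (B4 by `linarith` + `gagliardo_nonneg`; B5b = `essLocalClass`, PROVED);
* `chiralProfileRigidity_of` — **K2 `ChiralProfileRigidity` (text verbatim) FROM the spread text and the residue text**;
  `chiralProfileRigidity_of_B` — K2 from the four B-texts and the slice-analyticity text;
* `target_of` — **the door `Target` (text verbatim) FROM the texts of K1 `LocalPointZoomChiralWindow` and K2** (the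
  planner's `closes`).

So the OPEN content of S20 in the tree is exactly: K1 (zoom; the non-local functional's passage to the limit), B1′/B2′
(truncation limit + kernel bounds `|Λ(η_R²)| ≲ R⁻¹ ∧ R³‖x‖⁻⁴`), B3 (local helicity balance with the class pressure), B5a
(Gagliardo-form fractional Sobolev + Fatou) and the analyticity of `Λ` on mild Type-I slices (Grujić–Kukavica strip).

Seat nsreg-p6 g11 (THEOREMS-ONLY door sequels, DIRECTOR-NS g8 #32 (2)/#36); compositions by nsreg-p1 g16/g17.  WHAT
THIS IS NOT: not NS regularity (Clay A); K1, K2 and the B-stubs are NOT proved here — conditional compositions only;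
no route is opened.
-/

noncomputable section

-- the summit and its single sub-problem share the name (CONVENTIONS §1), as in every Theorems file
set_option linter.dupNamespace false

namespace Summit.NavierStokesRegularity.NavierStokesRegularity.Theorems.ChiralWindowDoorProfileRigidityOfStubs

open MeasureTheory Set Function Filter Topology Metric
open scoped NNReal ENNReal RealInnerProductSpace
open Literature.Analysis Literature.Analysis.FluidPDE
open Summit.NavierStokesRegularity.NavierStokesRegularity.Theorems.ChiralWindowDoorDefs
open Summit.NavierStokesRegularity.NavierStokesRegularity.Theorems.ChiralWindowDoorEssLocalClass (essLocalClass)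
open Summit.NavierStokesRegularity.NavierStokesRegularity.Theorems.LocalSineTubeDoorProfileAlignedWindowRigidityAncient
  (analyticOnNhd_slice bdd_of_hasTypeITimeDecay)
open Summit.NavierStokesRegularity.NavierStokesRegularity.Theorems.PoloidalWindowDoorPoloidalWindowRigiditySymmetryGerms
  (eq_of_eqOn_open)

/-! ### The spread stub from the analyticity of `Λ` on slices -/

/-- **The spread stub `stub_chiralSpread` of `r19/Sketch20v5.lean` (conclusion verbatim) FROM the one analytic input**:
if `Λ(v s)` is real-analytic on the slice, chirality `curl (v s) = Λ (v s)` on a nonempty open set spreads to the whole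
slice — door-class slices are real-analytic (`analyticOnNhd_slice`), hence so is their curl, and the identity theorem
applies (nsreg-p1 `r19/ChiralSpread.lean`). -/
theorem chiralSpread_of_sliceAnalytic {C : ℝ} {v : ℝ → EuclideanSpace ℝ (Fin 3) → EuclideanSpace ℝ (Fin 3)}
    (hrate : HasTypeITimeDecay C v) (hcont : ContinuousOn (Function.uncurry v) (Set.Iio (0 : ℝ) ×ˢ Set.univ))
    (hmild : ∀ s t : ℝ, s < t → t < 0 → ∀ x,
      v t x = UnboundedOperators.heatExtension (v s) (t - s) x - oseenDuhamel 1 s v v t x)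
    {s : ℝ} (hs : s < 0) (hΛ : AnalyticOnNhd ℝ (fracLapHalf (v s)) univ)
    {U : Set (EuclideanSpace ℝ (Fin 3))} (hU : IsOpen U) (hne : U.Nonempty)
    (hUz : ∀ z ∈ U, curl (v s) z = fracLapHalf (v s) z) : IsChiral (v s) := by
  intro x
  have hv : AnalyticOnNhd ℝ (v s) univ := analyticOnNhd_slice hcont (bdd_of_hasTypeITimeDecay hrate) hmild hs
  exact eq_of_eqOn_open (analyticOnNhd_curl hv) hΛ hU hne hUz x

/-- The spread stub with ALL the class hypotheses of its registered text (the unused ones discarded): class + «`Λ(v s)`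
real-analytic on every slice» ⇒ `stub_chiralSpread`'s conclusion. -/
theorem chiralSpread_of_sliceAnalytic' : ∀ (C D K : ℝ) (v : ℝ → EuclideanSpace ℝ (Fin 3) → EuclideanSpace ℝ (Fin 3)),
    HasTypeITimeDecay C v → HasTypeIDecay D v → HasTypeIDerivDecay K v →
    ContinuousOn (Function.uncurry v) (Set.Iio (0 : ℝ) ×ˢ Set.univ) →
    (∀ s t : ℝ, s < t → t < 0 → ∀ x,
        v t x = UnboundedOperators.heatExtension (v s) (t - s) x - oseenDuhamel 1 s v v t x) →
    (∀ t < 0, VectorCalculus.IsDivFree (v t)) →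
    (∀ s < (0 : ℝ), AnalyticOnNhd ℝ (fracLapHalf (v s)) univ) →
    ∀ s < (0 : ℝ), ∀ U : Set (EuclideanSpace ℝ (Fin 3)), IsOpen U → U.Nonempty →
      (∀ z ∈ U, curl (v s) z = fracLapHalf (v s) z) → IsChiral (v s) := by
  intro C D K v hrate _hdecay _hder hcont hmild _hdiv hΛ s hs U hU hne hUz
  exact chiralSpread_of_sliceAnalytic hrate hcont hmild hs (hΛ s hs) hU hne hUz

/-! ### The residue Liouville from the B-stubs (B4 bookkeeping, B5b proved) -/

/-- **The everywhere-form residue `HomochiralProfileRigidity` of `r19/Sketch20v5.lean` (text verbatim) FROM the texts of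
B1′ `stub_localHelicityLower`, B2′ `stub_localDissipationLower`, B3 `stub_helicityBudget` and B5a `stub_sobolevFatou`**
(each quantified exactly as registered).  B4: from B1′, B2′, B3 and `gagliardo ≥ 0`, `G_R(v(t₀)) ≤ c₁ + 2c₂ + c₃`
uniformly in `R, t₀`; then B5a gives slices bounded in `L³(B₁)` and B5b — PROVED,
`…ChiralWindowDoorEssLocalClass.essLocalClass` — refutes backward singularity (nsreg-p1's `HomochiralProfileRigidity_of_B`). -/
theorem homochiralProfileRigidity_of_B
    (hB1 : ∀ (η : EuclideanSpace ℝ (Fin 3) → ℝ), IsAdmissibleBump η → ∀ (C D K : ℝ)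
      (v : ℝ → EuclideanSpace ℝ (Fin 3) → EuclideanSpace ℝ (Fin 3)),
      HasTypeITimeDecay C v → HasTypeIDecay D v → HasTypeIDerivDecay K v →
      ContinuousOn (Function.uncurry v) (Set.Iio (0 : ℝ) ×ˢ Set.univ) →
      (∀ s t : ℝ, s < t → t < 0 → ∀ x,
          v t x = UnboundedOperators.heatExtension (v s) (t - s) x - oseenDuhamel 1 s v v t x) →
      (∀ t < 0, VectorCalculus.IsDivFree (v t)) → (∀ t < 0, IsChiral (v t)) →
      ∃ c : ℝ, ∀ R > (0 : ℝ), ∀ t < (0 : ℝ), gagliardo (bumpSq η R) (v t) ≤ locHelicity (bumpSq η R) (v t) + c)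
    (hB2 : ∀ (η : EuclideanSpace ℝ (Fin 3) → ℝ), IsAdmissibleBump η → ∀ (C D K : ℝ)
      (v : ℝ → EuclideanSpace ℝ (Fin 3) → EuclideanSpace ℝ (Fin 3)),
      HasTypeITimeDecay C v → HasTypeIDecay D v → HasTypeIDerivDecay K v →
      ContinuousOn (Function.uncurry v) (Set.Iio (0 : ℝ) ×ˢ Set.univ) →
      (∀ s t : ℝ, s < t → t < 0 → ∀ x,
          v t x = UnboundedOperators.heatExtension (v s) (t - s) x - oseenDuhamel 1 s v v t x) →
      (∀ t < 0, VectorCalculus.IsDivFree (v t)) → (∀ t < 0, IsChiral (v t)) →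
      ∃ c : ℝ, ∀ R > (0 : ℝ), ∀ t₀ < (0 : ℝ),
        ∫ t in Set.Iio t₀, gagliardo (bumpSq η R) (curl (v t)) ≤
          (∫ t in Set.Iio t₀, locHelicity (bumpSq η R) (curl (v t))) + c)
    (hB3 : ∀ (η : EuclideanSpace ℝ (Fin 3) → ℝ), IsAdmissibleBump η → ∀ (C D K : ℝ)
      (v : ℝ → EuclideanSpace ℝ (Fin 3) → EuclideanSpace ℝ (Fin 3)),
      HasTypeITimeDecay C v → HasTypeIDecay D v → HasTypeIDerivDecay K v →
      ContinuousOn (Function.uncurry v) (Set.Iio (0 : ℝ) ×ˢ Set.univ) →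
      (∀ s t : ℝ, s < t → t < 0 → ∀ x,
          v t x = UnboundedOperators.heatExtension (v s) (t - s) x - oseenDuhamel 1 s v v t x) →
      (∀ t < 0, VectorCalculus.IsDivFree (v t)) →
      ∃ c : ℝ, ∀ R > (0 : ℝ), ∀ t₀ < (0 : ℝ),
        locHelicity (bumpSq η R) (v t₀) + 2 * ∫ t in Set.Iio t₀, locHelicity (bumpSq η R) (curl (v t)) ≤ c)
    (hB5a : ∀ (η : EuclideanSpace ℝ (Fin 3) → ℝ), IsAdmissibleBump η → ∀ (C D K : ℝ)
      (v : ℝ → EuclideanSpace ℝ (Fin 3) → EuclideanSpace ℝ (Fin 3)),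
      HasTypeITimeDecay C v → HasTypeIDecay D v → HasTypeIDerivDecay K v →
      ContinuousOn (Function.uncurry v) (Set.Iio (0 : ℝ) ×ˢ Set.univ) →
      (∃ c : ℝ, ∀ R > (0 : ℝ), ∀ t₀ < (0 : ℝ), gagliardo (bumpSq η R) (v t₀) ≤ c) →
      ∃ M : NNReal, ∀ t ∈ Set.Ioo (-1 : ℝ) 0,
        ∫⁻ x in Metric.ball (0 : EuclideanSpace ℝ (Fin 3)) 1, ‖v t x‖ₑ ^ (3 : ℕ) ≤ M) :
    ∀ (C D K : ℝ) (v : ℝ → EuclideanSpace ℝ (Fin 3) → EuclideanSpace ℝ (Fin 3)), Literature.Analysis.FluidPDE.HasTypeITimeDecay C v → Literature.Analysis.FluidPDE.HasTypeIDecay D v → HasTypeIDerivDecay K v → ContinuousOn (Function.uncurry v) (Set.Iio (0 : ℝ) ×ˢ Set.univ) → (∀ s t : ℝ, s < t → t < 0 → ∀ x, v t x = Literature.Analysis.UnboundedOperators.heatExtension (v s) (t - s) x - Literature.Analysis.FluidPDE.oseenDuhamel 1 s v v t x) → (∀ t < 0, Literature.Analysis.FluidPDE.VectorCalculus.IsDivFree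 (v t)) → (∀ t < 0, IsChiral (v t)) → ¬ Literature.Analysis.FluidPDE.IsBackwardSingularPoint v 0 := by
  intro C D K v hrate hdecay hder hcont hmild hdiv hhom
  obtain ⟨η, hη⟩ := exists_admissibleBump
  obtain ⟨c₁, h₁⟩ := hB1 η hη C D K v hrate hdecay hder hcont hmild hdiv hhom
  obtain ⟨c₂, h₂⟩ := hB2 η hη C D K v hrate hdecay hder hcont hmild hdiv hhom
  obtain ⟨c₃, h₃⟩ := hB3 η hη C D K v hrate hdecay hder hcont hmild hdiv
  have hGbound : ∃ c : ℝ, ∀ R > (0 : ℝ), ∀ t₀ < (0 : ℝ), gagliardo (bumpSq η R) (v t₀) ≤ c := by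
    refine ⟨c₁ + 2 * c₂ + c₃, fun R hR t₀ ht₀ => ?_⟩
    have e₁ := h₁ R hR t₀ ht₀
    have e₂ := h₂ R hR t₀ ht₀
    have e₃ := h₃ R hR t₀ ht₀
    have hnn : 0 ≤ ∫ t in Set.Iio t₀, gagliardo (bumpSq η R) (curl (v t)) :=
      setIntegral_nonneg measurableSet_Iio fun t _ => gagliardo_nonneg (bumpSq_nonneg η R) _
    linarith
  have hL3 := hB5a η hη C D K v hrate hdecay hder hcont hGbound
  exact essLocalClass C D K v hrate hdecay hder hcont hmild hdiv hL3

/-! ### K2 from the spread and the residue; the door from K1 and K2 -/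

/-- **K2 `ChiralProfileRigidity` of `r19/Sketch20v5.lean` (text verbatim) FROM the text of the spread stub and the
text of the everywhere-form residue** (nsreg-p1's `ChiralProfileRigidity_of_stubs`). -/
theorem chiralProfileRigidity_of
    (hspread : ∀ (C D K : ℝ) (v : ℝ → EuclideanSpace ℝ (Fin 3) → EuclideanSpace ℝ (Fin 3)),
      HasTypeITimeDecay C v → HasTypeIDecay D v → HasTypeIDerivDecay K v →
      ContinuousOn (Function.uncurry v) (Set.Iio (0 : ℝ) ×ˢ Set.univ) →
      (∀ s t : ℝ, s < t → t < 0 → ∀ x,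
          v t x = UnboundedOperators.heatExtension (v s) (t - s) x - oseenDuhamel 1 s v v t x) →
      (∀ t < 0, VectorCalculus.IsDivFree (v t)) →
      ∀ s < (0 : ℝ), ∀ U : Set (EuclideanSpace ℝ (Fin 3)), IsOpen U → U.Nonempty →
        (∀ z ∈ U, curl (v s) z = fracLapHalf (v s) z) → IsChiral (v s))
    (hres : ∀ (C D K : ℝ) (v : ℝ → EuclideanSpace ℝ (Fin 3) → EuclideanSpace ℝ (Fin 3)), Literature.Analysis.FluidPDE.HasTypeITimeDecay C v → Literature.Analysis.FluidPDE.HasTypeIDecay D v → HasTypeIDerivDecay K v → ContinuousOn (Function.uncurry v) (Set.Iio (0 : ℝ) ×ˢ Set.univ) → (∀ s t : ℝ, s < t → t < 0 → ∀ x, v t x = Literature.Analysis.UnboundedOperators.heatExtension (v s) (t - s) x - Literature.Analysis.FluidPDE.oseenDuhamel 1 s v v t x) → (∀ t < 0, Literature.Analysis.FluidPDE.VectorCalculus.IsDivFree (v t)) → (∀ t < 0, IsChiral (v t)) → ¬ Literature.Analysis.FluidPDE.IsBackwardSingularPoint v 0) :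
    ∀ (C D K : ℝ) (v : ℝ → EuclideanSpace ℝ (Fin 3) → EuclideanSpace ℝ (Fin 3)), Literature.Analysis.FluidPDE.HasTypeITimeDecay C v → Literature.Analysis.FluidPDE.HasTypeIDecay D v → HasTypeIDerivDecay K v → ContinuousOn (Function.uncurry v) (Set.Iio (0 : ℝ) ×ˢ Set.univ) → (∀ s t : ℝ, s < t → t < 0 → ∀ x, v t x = Literature.Analysis.UnboundedOperators.heatExtension (v s) (t - s) x - Literature.Analysis.FluidPDE.oseenDuhamel 1 s v v t x) → (∀ t < 0, Literature.Analysis.FluidPDE.VectorCalculus.IsDivFree (v t)) → (∀ s < 0, ∃ U : Set (EuclideanSpace ℝ (Fin 3)), IsOpen U ∧ U.Nonempty ∧ ∀ z ∈ U, curl (v s) z = fracLapHalf (v s) z) → ¬ Literature.Analysis.FluidPDE.IsBackwardSingularPoint v 0 := by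
  intro C D K v hrate hdecay hgrad hcont hmild hdiv hwin
  refine hres C D K v hrate hdecay hgrad hcont hmild hdiv ?_
  intro t ht
  obtain ⟨U, hU, hne, hz⟩ := hwin t ht
  exact hspread C D K v hrate hdecay hgrad hcont hmild hdiv t ht U hU hne hz

/-- **K2 `ChiralProfileRigidity` (text verbatim) FROM the four open B-texts (B1′, B2′, B3, B5a) and the analyticity of
`Λ` on door-class slices** — the whole of nsreg-p1's R19 line with B4 and B5b discharged in the tree. -/
theorem chiralProfileRigidity_of_B
    (hB1 : ∀ (η : EuclideanSpace ℝ (Fin 3) → ℝ), IsAdmissibleBump η → ∀ (C D K : ℝ)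
      (v : ℝ → EuclideanSpace ℝ (Fin 3) → EuclideanSpace ℝ (Fin 3)),
      HasTypeITimeDecay C v → HasTypeIDecay D v → HasTypeIDerivDecay K v →
      ContinuousOn (Function.uncurry v) (Set.Iio (0 : ℝ) ×ˢ Set.univ) →
      (∀ s t : ℝ, s < t → t < 0 → ∀ x,
          v t x = UnboundedOperators.heatExtension (v s) (t - s) x - oseenDuhamel 1 s v v t x) →
      (∀ t < 0, VectorCalculus.IsDivFree (v t)) → (∀ t < 0, IsChiral (v t)) →
      ∃ c : ℝ, ∀ R > (0 : ℝ), ∀ t < (0 : ℝ), gagliardo (bumpSq η R) (v t) ≤ locHelicity (bumpSq η R) (v t) + c)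
    (hB2 : ∀ (η : EuclideanSpace ℝ (Fin 3) → ℝ), IsAdmissibleBump η → ∀ (C D K : ℝ)
      (v : ℝ → EuclideanSpace ℝ (Fin 3) → EuclideanSpace ℝ (Fin 3)),
      HasTypeITimeDecay C v → HasTypeIDecay D v → HasTypeIDerivDecay K v →
      ContinuousOn (Function.uncurry v) (Set.Iio (0 : ℝ) ×ˢ Set.univ) →
      (∀ s t : ℝ, s < t → t < 0 → ∀ x,
          v t x = UnboundedOperators.heatExtension (v s) (t - s) x - oseenDuhamel 1 s v v t x) →
      (∀ t < 0, VectorCalculus.IsDivFree (v t)) → (∀ t < 0, IsChiral (v t)) →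
      ∃ c : ℝ, ∀ R > (0 : ℝ), ∀ t₀ < (0 : ℝ),
        ∫ t in Set.Iio t₀, gagliardo (bumpSq η R) (curl (v t)) ≤
          (∫ t in Set.Iio t₀, locHelicity (bumpSq η R) (curl (v t))) + c)
    (hB3 : ∀ (η : EuclideanSpace ℝ (Fin 3) → ℝ), IsAdmissibleBump η → ∀ (C D K : ℝ)
      (v : ℝ → EuclideanSpace ℝ (Fin 3) → EuclideanSpace ℝ (Fin 3)),
      HasTypeITimeDecay C v → HasTypeIDecay D v → HasTypeIDerivDecay K v →
      ContinuousOn (Function.uncurry v) (Set.Iio (0 : ℝ) ×ˢ Set.univ) →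
      (∀ s t : ℝ, s < t → t < 0 → ∀ x,
          v t x = UnboundedOperators.heatExtension (v s) (t - s) x - oseenDuhamel 1 s v v t x) →
      (∀ t < 0, VectorCalculus.IsDivFree (v t)) →
      ∃ c : ℝ, ∀ R > (0 : ℝ), ∀ t₀ < (0 : ℝ),
        locHelicity (bumpSq η R) (v t₀) + 2 * ∫ t in Set.Iio t₀, locHelicity (bumpSq η R) (curl (v t)) ≤ c)
    (hB5a : ∀ (η : EuclideanSpace ℝ (Fin 3) → ℝ), IsAdmissibleBump η → ∀ (C D K : ℝ)
      (v : ℝ → EuclideanSpace ℝ (Fin 3) → EuclideanSpace ℝ (Fin 3)),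
      HasTypeITimeDecay C v → HasTypeIDecay D v → HasTypeIDerivDecay K v →
      ContinuousOn (Function.uncurry v) (Set.Iio (0 : ℝ) ×ˢ Set.univ) →
      (∃ c : ℝ, ∀ R > (0 : ℝ), ∀ t₀ < (0 : ℝ), gagliardo (bumpSq η R) (v t₀) ≤ c) →
      ∃ M : NNReal, ∀ t ∈ Set.Ioo (-1 : ℝ) 0,
        ∫⁻ x in Metric.ball (0 : EuclideanSpace ℝ (Fin 3)) 1, ‖v t x‖ₑ ^ (3 : ℕ) ≤ M)
    (hΛ : ∀ (C D K : ℝ) (v : ℝ → EuclideanSpace ℝ (Fin 3) → EuclideanSpace ℝ (Fin 3)),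
      HasTypeITimeDecay C v → HasTypeIDecay D v → HasTypeIDerivDecay K v →
      ContinuousOn (Function.uncurry v) (Set.Iio (0 : ℝ) ×ˢ Set.univ) →
      (∀ s t : ℝ, s < t → t < 0 → ∀ x,
          v t x = UnboundedOperators.heatExtension (v s) (t - s) x - oseenDuhamel 1 s v v t x) →
      ∀ s < (0 : ℝ), AnalyticOnNhd ℝ (fracLapHalf (v s)) univ) :
    ∀ (C D K : ℝ) (v : ℝ → EuclideanSpace ℝ (Fin 3) → EuclideanSpace ℝ (Fin 3)), Literature.Analysis.FluidPDE.HasTypeITimeDecay C v → Literature.Analysis.FluidPDE.HasTypeIDecay D v → HasTypeIDerivDecay K v → ContinuousOn (Function.uncurry v) (Set.Iio (0 : ℝ) ×ˢ Set.univ) → (∀ s t : ℝ, s < t → t < 0 → ∀ x, v t x = Literature.Analysis.UnboundedOperators.heatExtension (v s) (t - s) x - Literature.Analysis.FluidPDE.oseenDuhamel 1 s v v t x) → (∀ t < 0, Literature.Analysis.FluidPDE.VectorCalculus.IsDivFree (v t)) → (∀ s < 0, ∃ U : Set (EuclideanSpace ℝ (Fin 3)), IsOpen U ∧ U.Nonempty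 ∧ ∀ z ∈ U, curl (v s) z = fracLapHalf (v s) z) → ¬ Literature.Analysis.FluidPDE.IsBackwardSingularPoint v 0 :=
  chiralProfileRigidity_of
    (fun C D K v hrate hdecay hder hcont hmild _hdiv s hs _U hU hne hUz =>
      chiralSpread_of_sliceAnalytic hrate hcont hmild hs (hΛ C D K v hrate hdecay hder hcont hmild s hs) hU hne hUz)
    (homochiralProfileRigidity_of_B hB1 hB2 hB3 hB5a)

/-- **The door `Target` of `r19/Sketch20v5.lean` (text verbatim) FROM the texts of K1 `LocalPointZoomChiralWindow` and
K2 `ChiralProfileRigidity`** — the planner's deciding theorem `closes`, kernel-resident. -/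
theorem target_of
    (h₁ : ∀ (ν T : ℝ), 0 < ν → 0 < T → ∀ (u : ℝ → EuclideanSpace ℝ (Fin 3) → EuclideanSpace ℝ (Fin 3)) (p : ℝ → EuclideanSpace ℝ (Fin 3) → ℝ), Literature.Analysis.FluidPDE.IsClassicalNSSolutionOn (Set.Ico 0 T) ν 0 u p → Literature.Analysis.FluidPDE.IsLerayHopfOn T ν 0 (u 0) u → Literature.Analysis.FluidPDE.HasRapidSpatialDecay (u 0) → ∀ (x₀ : EuclideanSpace ℝ (Fin 3)) (ρ M : ℝ), 0 < ρ → (∀ t ∈ Set.Ico 0 T, T - ρ ^ 2 < t → ∀ x ∈ Metric.ball x₀ ρ, ‖u t x‖ * (‖x - x₀‖ + Real.sqrt (ν * (T - t))) ≤ M) → ∀ (U : Set (EuclideanSpace ℝ (Fin 3))), IsOpen U → U.Nonempty → Filter.Tendsto (fun t => ∫⁻ y in U, ENNReal.ofReal ‖(T - t) • (curl (u t) (x₀ + Real.sqrt (T - t) • y) - fracLapHalf (u t) (x₀ + Real.sqrt (T - t) • y))‖) (nhdsWithin T (Set.Iio T)) (nhds 0) → ¬ Literature.Analysis.FluidPDE.IsBackwardBoundedAt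 u T x₀ → ∃ (C D K : ℝ) (v : ℝ → EuclideanSpace ℝ (Fin 3) → EuclideanSpace ℝ (Fin 3)), Literature.Analysis.FluidPDE.HasTypeITimeDecay C v ∧ Literature.Analysis.FluidPDE.HasTypeIDecay D v ∧ HasTypeIDerivDecay K v ∧ ContinuousOn (Function.uncurry v) (Set.Iio (0 : ℝ) ×ˢ Set.univ) ∧ (∀ s t : ℝ, s < t → t < 0 → ∀ x, v t x = Literature.Analysis.UnboundedOperators.heatExtension (v s) (t - s) x - Literature.Analysis.FluidPDE.oseenDuhamel 1 s v v t x) ∧ (∀ t < 0, Literature.Analysis.FluidPDE.VectorCalculus.IsDivFree (v t)) ∧ Literature.Analysis.FluidPDE.IsBackwardSingularPoint v 0 ∧ (∀ s < 0, ∃ U : Set (EuclideanSpace ℝ (Fin 3)), IsOpen U ∧ U.Nonempty ∧ ∀ z ∈ U, curl (v s) z = fracLapHalf (v s) z))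
    (h₂ : ∀ (C D K : ℝ) (v : ℝ → EuclideanSpace ℝ (Fin 3) → EuclideanSpace ℝ (Fin 3)), Literature.Analysis.FluidPDE.HasTypeITimeDecay C v → Literature.Analysis.FluidPDE.HasTypeIDecay D v → HasTypeIDerivDecay K v → ContinuousOn (Function.uncurry v) (Set.Iio (0 : ℝ) ×ˢ Set.univ) → (∀ s t : ℝ, s < t → t < 0 → ∀ x, v t x = Literature.Analysis.UnboundedOperators.heatExtension (v s) (t - s) x - Literature.Analysis.FluidPDE.oseenDuhamel 1 s v v t x) → (∀ t < 0, Literature.Analysis.FluidPDE.VectorCalculus.IsDivFree (v t)) → (∀ s < 0, ∃ U : Set (EuclideanSpace ℝ (Fin 3)), IsOpen U ∧ U.Nonempty ∧ ∀ z ∈ U, curl (v s) z = fracLapHalf (v s) z) → ¬ Literature.Analysis.FluidPDE.IsBackwardSingularPoint v 0) :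
    ∀ (ν T : ℝ), 0 < ν → 0 < T → ∀ (u : ℝ → EuclideanSpace ℝ (Fin 3) → EuclideanSpace ℝ (Fin 3)) (p : ℝ → EuclideanSpace ℝ (Fin 3) → ℝ), Literature.Analysis.FluidPDE.IsClassicalNSSolutionOn (Set.Ico 0 T) ν 0 u p → Literature.Analysis.FluidPDE.IsLerayHopfOn T ν 0 (u 0) u → Literature.Analysis.FluidPDE.HasRapidSpatialDecay (u 0) → ∀ (x₀ : EuclideanSpace ℝ (Fin 3)) (ρ M : ℝ), 0 < ρ → (∀ t ∈ Set.Ico 0 T, T - ρ ^ 2 < t → ∀ x ∈ Metric.ball x₀ ρ, ‖u t x‖ * (‖x - x₀‖ + Real.sqrt (ν * (T - t))) ≤ M) → ∀ (U : Set (EuclideanSpace ℝ (Fin 3))), IsOpen U → U.Nonempty → Filter.Tendsto (fun t => ∫⁻ y in U, ENNReal.ofReal ‖(T - t) • (curl (u t) (x₀ + Real.sqrt (T - t) • y) - fracLapHalf (u t) (x₀ + Real.sqrt (T - t) • y))‖) (nhdsWithin T (Set.Iio T)) (nhds 0) → Literature.Analysis.FluidPDE.IsBackwardBoundedAt u T x₀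 := by
  intro ν T hν hT u p hcl hLH hdec x₀ ρ M hρ hM U hU hUne hfade
  by_contra hnot
  obtain ⟨C, D, K, v, hrate, hdecay, hgrad, hcont, hmild, hdiv, hsing, hwin⟩ :=
    h₁ ν T hν hT u p hcl hLH hdec x₀ ρ M hρ hM U hU hUne hfade hnot
  exact h₂ C D K v hrate hdecay hgrad hcont hmild hdiv hwin hsing

end Summit.NavierStokesRegularity.NavierStokesRegularity.Theorems.ChiralWindowDoorProfileRigidityOfStubs
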